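import Literature.Analysis.FluidPDE.SlabTypeICompactness
import Literature.Analysis.FluidPDE.LocalTypeIScaling

/-!
# Route RellichScar — item `TypeIBlowupProfile` (stmt-NavierStokesRegularity-1591): the zoom-in limit

Helper file (theorems only) for `RellichScarTypeIBlowupProfile.lean`.  The zoom-in at a local
Type I singular point — scales `λⱼ → 0⁺`, approximants `λⱼ v(λⱼ² s, λⱼ y)`, `λⱼ² π(λⱼ² s, λⱼ y)`
converging on every parabolic ball `Q(0, a)` (velocities strongly in `L³`, pressures weakly in
`L^{3/2}`) to a pair `(w, ϖ)` suitable in every `Q(0, a)`, as produced by the tree's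
`Seregin2020.exists_ancientLimit` (Seregin 2014, Prop. 6.20) — yields a profile on the backward
slab `ℝ³ × ℝ₋`:

* `slab_typeIBound_of_zoomLimit` — `(w, ϖ)` is a suitable weak solution on the slab with a weak
  spatial gradient `H` and `𝐈(w, ϖ, H; ℝ³ × ℝ₋) ≤ 4 𝐈(v, π, G; Q(0, ρ))` (Albritton–Barker 2019,
  §3, "(3.6) follows from (3.3)": suitability and `H` glue along the exhaustion `Q(0, n+1)`; on
  every admissible ball the approximants eventually have `A, C, D, E ≤ 𝐈(Q(0, ρ))` by the scale
  invariance of `𝐈`, and `A, C, D, E` are lower semicontinuous — the tree's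
  `cknAEss_le_of_tendsto_eLpNorm`, `cknC_le_of_tendsto_eLpNorm`, `cknDOsc_le_of_tendsto_weakly`,
  `cknE_le_of_tendsto_eLpNorm`); this is Step 3–4 of the tree's `slab_typeI_compactness` run for
  approximants living on the growing balls `Q(0, ρ/λⱼ)` instead of the whole slab;
* `norm_nsZoom_le_rate`, `ae_rate_of_zoomLimit` — the Type-I rate `‖v(s, y)‖ ≤ C/√(−s)` on a final
  window is invariant under the zoom and passes to the limit almost everywhere on the slab.

## References

* D. Albritton, T. Barker, J. Math. Fluid Mech. 21 (2019), no. 43 = arXiv:1811.00502, §3.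
  [AlbrittonBarker2019]
* G. Seregin, *Lecture Notes on Regularity Theory for the Navier–Stokes Equations*, World
  Scientific (2014), §6.6, Prop. 6.20. [Seregin2014]
* G. Koch, N. Nadirashvili, G. Seregin, V. Šverák, Acta Math. 203 (2009), (1.4). [KNSS2009]
-/

noncomputable section

set_option linter.dupNamespace false

namespace Summit.NavierStokesRegularity.NavierStokesRegularity.Theorems

open MeasureTheory Set Function Filter Topology TopologicalSpace Metric
open Literature.Analysis.FluidPDE
open scoped NNReal ENNReal

/-- **The Type-I rate is invariant under the Navier–Stokes zoom about the origin.** If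
`‖v(s, y)‖ ≤ C/√(−s)` for `−δ₁ < s < 0`, then the zoom `v_c(s, y) = c v(c² s, c y)`, `c > 0`,
satisfies the same bound for `−δ₁/c² < s < 0`. [cite: KNSS2009, (1.4)] -/
theorem norm_nsZoom_le_rate {v : ℝ → EuclideanSpace ℝ (Fin 3) → EuclideanSpace ℝ (Fin 3)}
    {C δ₁ c : ℝ} (hc : 0 < c)
    (hrate : ∀ s ∈ Ioo (-δ₁) 0, ∀ y, ‖v s y‖ ≤ C / Real.sqrt (-s))
    {s : ℝ} (hs : s ∈ Ioo (-(δ₁ / c ^ 2)) 0) (y : EuclideanSpace ℝ (Fin 3)) :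
    ‖(c • stPull (c ^ 2) c (0 : ℝ) (0 : EuclideanSpace ℝ (Fin 3)) v) s y‖ ≤ C / Real.sqrt (-s) := by
  have hc2 : 0 < c ^ 2 := pow_pos hc 2
  have hs1 : -δ₁ < c ^ 2 * s := by
    have h := mul_lt_mul_of_pos_left hs.1 hc2
    rwa [mul_neg, mul_div_cancel₀ _ hc2.ne'] at h
  have hs2 : c ^ 2 * s < 0 := mul_neg_of_pos_of_neg hc2 hs.2
  have hb := hrate (c ^ 2 * s) ⟨hs1, hs2⟩ (c • y)
  have hsq : Real.sqrt (-(c ^ 2 * s)) = c * Real.sqrt (-s) := by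
    rw [show -(c ^ 2 * s) = c ^ 2 * (-s) by ring, Real.sqrt_mul hc2.le, Real.sqrt_sq hc.le]
  rw [hsq] at hb
  have hpos : 0 < Real.sqrt (-s) := Real.sqrt_pos.2 (by linarith [hs.2])
  rw [smul_stPull_apply, zero_add, zero_add, norm_smul, Real.norm_of_nonneg hc.le]
  calc c * ‖v (c ^ 2 * s) (c • y)‖ ≤ c * (C / (c * Real.sqrt (-s))) :=
        mul_le_mul_of_nonneg_left hb hc.le
    _ = C / Real.sqrt (-s) := by field_simp

/-- **The Type-I rate passes to the zoom-in limit, almost everywhere on the slab.** If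
`‖v(s, y)‖ ≤ C/√(−s)` on a final window `−δ₁ < s < 0` and the zooms `λⱼ v(λⱼ² s, λⱼ y)`,
`λⱼ → 0⁺`, converge to `w` in `L³(Q(0, a))` for every `a > 0`, then `‖w(s, y)‖ ≤ C/√(−s)` for
a.e. `(s, y) ∈ ℝ₋ × ℝ³` (on each `Q(0, a)` the approximants eventually obey the bound pointwise,
and a subsequence converges a.e.). [cite: KNSS2009, (1.4); AlbrittonBarker2019, §3] -/
theorem ae_rate_of_zoomLimit {v w : ℝ → EuclideanSpace ℝ (Fin 3) → EuclideanSpace ℝ (Fin 3)}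
    {C δ₁ : ℝ} (hδ₁ : 0 < δ₁)
    (hrate : ∀ s ∈ Ioo (-δ₁) 0, ∀ y, ‖v s y‖ ≤ C / Real.sqrt (-s))
    {lam : ℕ → ℝ} (hlam : ∀ j, 0 < lam j) (hlam0 : Tendsto lam atTop (𝓝 0))
    (hvm : ∀ a : ℝ, 0 < a → ∀ᶠ j in atTop, AEStronglyMeasurable
      (uncurry ((lam j) • stPull ((lam j) ^ 2) (lam j) (0 : ℝ) (0 : EuclideanSpace ℝ (Fin 3)) v))
      (volume.restrict (parabolicCylinder a (0 : ℝ × EuclideanSpace ℝ (Fin 3)))))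
    (hlim : ∀ a : ℝ, 0 < a →
      AEStronglyMeasurable (uncurry w)
        (volume.restrict (parabolicCylinder a (0 : ℝ × EuclideanSpace ℝ (Fin 3)))) ∧
      Tendsto (fun j => eLpNorm
          (uncurry ((lam j) • stPull ((lam j) ^ 2) (lam j) (0 : ℝ)
            (0 : EuclideanSpace ℝ (Fin 3)) v) - uncurry w) 3
          (volume.restrict (parabolicCylinder a (0 : ℝ × EuclideanSpace ℝ (Fin 3)))))
        atTop (𝓝 0)) :
    ∀ᵐ z ∂(volume.restrict (Iio (0 : ℝ) ×ˢ (univ : Set (EuclideanSpace ℝ (Fin 3))))),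
      ‖w z.1 z.2‖ ≤ C / Real.sqrt (-z.1) := by
  -- reduce to the exhausting balls `Q(0, n + 1)`
  have hcover : Iio (0 : ℝ) ×ˢ (univ : Set (EuclideanSpace ℝ (Fin 3))) ⊆
      ⋃ n : ℕ, parabolicCylinder ((n : ℝ) + 1) (0 : ℝ × EuclideanSpace ℝ (Fin 3)) := by
    rintro ⟨s, y⟩ ⟨hs, -⟩
    obtain ⟨n, hn⟩ := exists_nat_ge (max (-s) ‖y‖)
    have h1 : -s ≤ n := (le_max_left _ _).trans hn
    have h2 : ‖y‖ ≤ n := (le_max_right _ _).trans hn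
    have hs' : s < 0 := hs
    refine mem_iUnion.2 ⟨n, ?_⟩
    rw [SuitableCompactness.mem_parabolicCylinder_zero]
    refine ⟨⟨?_, hs'⟩, by simp only; linarith⟩
    have h3 : (n : ℝ) + 1 ≤ ((n : ℝ) + 1) ^ 2 := by nlinarith [n.cast_nonneg (α := ℝ)]
    simp only
    linarith
  refine ae_restrict_of_ae_restrict_of_subset hcover ?_
  rw [ae_restrict_iUnion_iff]
  intro n
  set a : ℝ := (n : ℝ) + 1 with ha
  have ha0 : 0 < a := by positivity
  set Q₀ : Set (ℝ × EuclideanSpace ℝ (Fin 3)) :=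
    parabolicCylinder a (0 : ℝ × EuclideanSpace ℝ (Fin 3)) with hQ₀
  obtain ⟨hwm, hconv⟩ := hlim a ha0
  -- eventually: measurable, and the scale is below `√δ₁ / a`
  have hev1 : ∀ᶠ j in atTop, lam j < Real.sqrt δ₁ / a :=
    hlam0 (Iio_mem_nhds (div_pos (Real.sqrt_pos.2 hδ₁) ha0))
  obtain ⟨J, hJ⟩ := eventually_atTop.1 ((hvm a ha0).and hev1)
  have hconv' : Tendsto (fun j => eLpNorm
      (uncurry ((lam (j + J)) • stPull ((lam (j + J)) ^ 2) (lam (j + J)) (0 : ℝ)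
        (0 : EuclideanSpace ℝ (Fin 3)) v) - uncurry w) 3 (volume.restrict Q₀)) atTop (𝓝 0) :=
    hconv.comp (tendsto_add_atTop_nat J)
  have hmeasJ : ∀ j, AEStronglyMeasurable
      (uncurry ((lam (j + J)) • stPull ((lam (j + J)) ^ 2) (lam (j + J)) (0 : ℝ)
        (0 : EuclideanSpace ℝ (Fin 3)) v)) (volume.restrict Q₀) := fun j =>
    (hJ (j + J) (Nat.le_add_left J j)).1
  have hTIM : TendstoInMeasure (volume.restrict Q₀)
      (fun j => uncurry ((lam (j + J)) • stPull ((lam (j + J)) ^ 2) (lam (j + J)) (0 : ℝ)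
        (0 : EuclideanSpace ℝ (Fin 3)) v)) atTop (uncurry w) :=
    tendstoInMeasure_of_tendsto_eLpNorm (by norm_num) hmeasJ hwm hconv'
  obtain ⟨ns, -, hae⟩ := hTIM.exists_seq_tendsto_ae
  -- the approximants obey the rate pointwise on `Q₀`
  have hptw : ∀ j, ∀ z ∈ Q₀, ‖uncurry ((lam (j + J)) • stPull ((lam (j + J)) ^ 2) (lam (j + J))
      (0 : ℝ) (0 : EuclideanSpace ℝ (Fin 3)) v) z‖ ≤ C / Real.sqrt (-z.1) := by
    intro j z hz
    obtain ⟨s, y⟩ := z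
    rw [hQ₀, SuitableCompactness.mem_parabolicCylinder_zero] at hz
    have hμ : 0 < lam (j + J) := hlam _
    have hμa : lam (j + J) < Real.sqrt δ₁ / a := (hJ (j + J) (Nat.le_add_left J j)).2
    have h1 : lam (j + J) * a < Real.sqrt δ₁ := by rwa [lt_div_iff₀ ha0] at hμa
    have h2 : (lam (j + J)) ^ 2 * a ^ 2 < δ₁ := by
      have h3 : (lam (j + J) * a) ^ 2 < (Real.sqrt δ₁) ^ 2 :=
        pow_lt_pow_left₀ h1 (by positivity) two_ne_zero
      rwa [mul_pow, Real.sq_sqrt hδ₁.le] at h3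
    have hs : s ∈ Ioo (-(δ₁ / (lam (j + J)) ^ 2)) 0 := by
      refine ⟨?_, hz.1.2⟩
      rw [neg_lt, lt_div_iff₀ (pow_pos hμ 2)]
      have := hz.1.1
      simp only at this
      nlinarith [pow_pos hμ 2]
    exact norm_nsZoom_le_rate hμ hrate hs y
  -- pass to the a.e. limit along `ns`
  filter_upwards [hae, ae_restrict_mem (isOpen_parabolicCylinder a _).measurableSet] with z hz hzQ
  exact le_of_tendsto hz.norm (Eventually.of_forall fun k => hptw (ns k) z hzQ)

/-- **The zoom-in limit at a local Type I point is a slab profile with `𝐈 ≤ 4 I`.**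
Let `(v, π)` be a suitable weak solution in the parabolic ball `Q(0, ρ)` (Albritton–Barker Def. 2.1)
with weak spatial gradient `G` and `𝐈(Q(0, ρ)) ≤ I < ∞`, and let `(w, ϖ)` be the limit, on every
ball `Q(0, a)`, of the zooms `λⱼ v(λⱼ² s, λⱼ y)`, `λⱼ² π(λⱼ² s, λⱼ y)` along scales `λⱼ → 0⁺`
(velocities strongly in `L³`, pressures weakly in `L^{3/2}`), `(w, ϖ)` being suitable in every
`Q(0, a)`. Then `(w, ϖ)` is a suitable weak solution on the backward slab `ℝ³ × ℝ₋` with a weak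
spatial gradient `H` and `𝐈(ℝ³ × ℝ₋) ≤ 4 I` (suitability and `H` glue along the exhaustion
`Q(0, n+1)`; on every admissible ball the approximants eventually have `A, C, D, E ≤ I` by scale
invariance of `𝐈`, and `A, C, D, E` are lower semicontinuous). This is Step (3.6)-from-(3.3) of
Albritton–Barker 2019, §3, run for the zoom-IN at a Type I point.
[cite: AlbrittonBarker2019, §3 (3.3)–(3.6); Seregin2014, §6.6 Prop. 6.20] -/
theorem slab_typeIBound_of_zoomLimit (I : ℝ≥0∞) (hI : I < ⊤)
    {v : ℝ → EuclideanSpace ℝ (Fin 3) → EuclideanSpace ℝ (Fin 3)}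
    {π : ℝ → EuclideanSpace ℝ (Fin 3) → ℝ}
    {G : ℝ → EuclideanSpace ℝ (Fin 3) → EuclideanSpace ℝ (Fin 3) →L[ℝ] EuclideanSpace ℝ (Fin 3)}
    {ρ : ℝ} (hρ : 0 < ρ)
    (hballv : IsSuitableWeakSolutionInBall ρ (0 : ℝ × EuclideanSpace ℝ (Fin 3)) v π)
    (hGv : HasWeakSpatialGradientOn
      (parabolicCylinderOpens ρ (0 : ℝ × EuclideanSpace ℝ (Fin 3))) v G)
    (hbd : typeIBound (parabolicCylinder ρ (0 : ℝ × EuclideanSpace ℝ (Fin 3))) v π G ≤ I)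
    {lam : ℕ → ℝ} (hlam : ∀ j, 0 < lam j) (hlam0 : Tendsto lam atTop (𝓝 0))
    {w : ℝ → EuclideanSpace ℝ (Fin 3) → EuclideanSpace ℝ (Fin 3)}
    {ϖ : ℝ → EuclideanSpace ℝ (Fin 3) → ℝ}
    (hlim : ∀ a : ℝ, 0 < a →
        IsSuitableWeakSolutionInBall a 0 w ϖ ∧
        MemLp (uncurry w) 3
          (volume.restrict (parabolicCylinder a (0 : ℝ × EuclideanSpace ℝ (Fin 3)))) ∧
        Tendsto (fun j => eLpNorm
            (uncurry ((lam j) • stPull ((lam j) ^ 2) (lam j) (0 : ℝ)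
              (0 : EuclideanSpace ℝ (Fin 3)) v) - uncurry w) 3
            (volume.restrict (parabolicCylinder a (0 : ℝ × EuclideanSpace ℝ (Fin 3)))))
          atTop (𝓝 0) ∧
        (∀ g : ℝ × EuclideanSpace ℝ (Fin 3) → ℝ,
          MemLp g 3 (volume.restrict (parabolicCylinder a (0 : ℝ × EuclideanSpace ℝ (Fin 3)))) →
          Tendsto (fun j => ∫ w' in parabolicCylinder a (0 : ℝ × EuclideanSpace ℝ (Fin 3)),
              ((lam j) ^ 2 • stPull ((lam j) ^ 2) (lam j) (0 : ℝ)
                (0 : EuclideanSpace ℝ (Fin 3)) π) w'.1 w'.2 * g w')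
            atTop (𝓝 (∫ w' in parabolicCylinder a (0 : ℝ × EuclideanSpace ℝ (Fin 3)),
              ϖ w'.1 w'.2 * g w')))) :
    IsSuitableWeakSolutionOn (slab (EuclideanSpace ℝ (Fin 3)) (Iio 0) isOpen_Iio) 1 0 w ϖ ∧
    ∃ H : ℝ → EuclideanSpace ℝ (Fin 3) → EuclideanSpace ℝ (Fin 3) →L[ℝ] EuclideanSpace ℝ (Fin 3),
      HasWeakSpatialGradientOn (slab (EuclideanSpace ℝ (Fin 3)) (Iio 0) isOpen_Iio) w H ∧
      typeIBound (Iio (0 : ℝ) ×ˢ univ) w ϖ H ≤ 4 * I := by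
  have hItop : I ≠ ⊤ := hI.ne
  -- ## suitability on the slab and the weak gradient, by exhaustion
  have hswu : IsSuitableWeakSolutionOn (slab (EuclideanSpace ℝ (Fin 3)) (Iio 0) isOpen_Iio) 1 0 w ϖ :=
    ESSBlowup.isSuitableWeakSolutionOn_halfspace fun a ha => (hlim a ha).1
  set Qn : ℕ → Opens (ℝ × EuclideanSpace ℝ (Fin 3)) :=
    fun n => parabolicCylinderOpens ((n : ℝ) + 1) (0 : ℝ × EuclideanSpace ℝ (Fin 3)) with hQn
  have hmono : Monotone Qn := fun m n hmn z hz =>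
    SuitableCompactness.parabolicCylinder_zero_mono (by positivity) (by simpa using hmn) hz
  have hcov : ∀ K ⊆ ((slab (EuclideanSpace ℝ (Fin 3)) (Iio 0) isOpen_Iio :
      Opens (ℝ × EuclideanSpace ℝ (Fin 3))) : Set (ℝ × EuclideanSpace ℝ (Fin 3))),
      IsCompact K → ∃ n, K ⊆ (Qn n : Set (ℝ × EuclideanSpace ℝ (Fin 3))) := fun K hK hKc =>
    ESSBlowup.exists_subset_parabolicCylinder_of_isCompact hK hKc
  choose Gn hGn hGn2 using fun n : ℕ => (hlim ((n : ℝ) + 1) (by positivity)).1.2.2.1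
  obtain ⟨H, hH, hHae⟩ := exists_hasWeakSpatialGradientOn_of_exhaustion
    (Q := slab (EuclideanSpace ℝ (Fin 3)) (Iio 0) isOpen_Iio) (Qn := Qn) hmono hcov hGn
  refine ⟨hswu, H, hH, ?_⟩
  -- ## `𝐈(w, ϖ, H) ≤ 4 I` by lower semicontinuity of `A, C, D, E` on every admissible ball
  refine typeIBound_le_iff.2 fun r hr z hz => ?_
  -- an exhausting ball `Q₀ = Q(0, n + 1) ⊇ Q(z, r)`
  obtain ⟨n, hn⟩ : ∃ n : ℕ, parabolicCylinder r z ⊆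
      parabolicCylinder ((n : ℝ) + 1) (0 : ℝ × EuclideanSpace ℝ (Fin 3)) := by
    obtain ⟨n, hn⟩ := exists_nat_ge (max (r ^ 2 - z.1) (‖z.2‖ + r))
    refine ⟨n, fun w hw => ?_⟩
    have hw0 : w.1 < 0 := (hz hw).1
    rw [mem_parabolicCylinder] at hw
    rw [SuitableCompactness.mem_parabolicCylinder_zero]
    have h1 : r ^ 2 - z.1 ≤ n := (le_max_left _ _).trans hn
    have h2 : ‖z.2‖ + r ≤ n := (le_max_right _ _).trans hn
    have h3 : (n : ℝ) ≤ ((n : ℝ) + 1) ^ 2 := by nlinarith [n.cast_nonneg (α := ℝ)]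
    refine ⟨⟨by linarith [hw.1.1], hw0⟩, ?_⟩
    calc ‖w.2‖ = ‖(w.2 - z.2) + z.2‖ := by rw [sub_add_cancel]
      _ ≤ ‖w.2 - z.2‖ + ‖z.2‖ := norm_add_le _ _
      _ < r + ‖z.2‖ := by rw [← dist_eq_norm]; linarith [hw.2]
      _ ≤ (n : ℝ) + 1 := by linarith
  set a : ℝ := (n : ℝ) + 1 with ha
  have ha0 : 0 < a := by positivity
  set Q₀ : Set (ℝ × EuclideanSpace ℝ (Fin 3)) :=
    parabolicCylinder a (0 : ℝ × EuclideanSpace ℝ (Fin 3)) with hQ₀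
  have hzQ : parabolicCylinder r z ⊆ Q₀ := hn
  obtain ⟨hballu, hum3, hconv, hweak⟩ := hlim a ha0
  have hleΩ : parabolicCylinderOpens r z ≤
      (slab (EuclideanSpace ℝ (Fin 3)) (Iio 0) isOpen_Iio : Opens (ℝ × EuclideanSpace ℝ (Fin 3))) :=
    fun w hw => hz hw
  -- the scales are eventually `≤ ρ / a`
  obtain ⟨J, hJ⟩ : ∃ J : ℕ, ∀ j, J ≤ j → lam j * a ≤ ρ := by
    have hev : ∀ᶠ j in atTop, lam j < ρ / a := hlam0 (Iio_mem_nhds (div_pos hρ ha0))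
    obtain ⟨J, hJ⟩ := eventually_atTop.1 hev
    refine ⟨J, fun j hj => ?_⟩
    have := hJ j hj
    rw [lt_div_iff₀ ha0] at this
    exact this.le
  -- the shifted approximants
  have hμ : ∀ j, 0 < lam (j + J) := fun j => hlam _
  have hdom : ∀ j, Q₀ ⊆ parabolicCylinder (ρ / lam (j + J)) (0 : ℝ × EuclideanSpace ℝ (Fin 3)) := by
    intro j
    refine SuitableCompactness.parabolicCylinder_zero_mono ha0.le ?_
    rw [le_div_iff₀ (hμ j), mul_comm]
    exact hJ (j + J) (Nat.le_add_left J j)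
  have hconv' : Tendsto (fun j => eLpNorm
      (uncurry ((lam (j + J)) • stPull ((lam (j + J)) ^ 2) (lam (j + J)) (0 : ℝ)
        (0 : EuclideanSpace ℝ (Fin 3)) v) - uncurry w) 3 (volume.restrict Q₀)) atTop (𝓝 0) :=
    hconv.comp (tendsto_add_atTop_nat J)
  have hweak' : ∀ g : ℝ × EuclideanSpace ℝ (Fin 3) → ℝ, MemLp g 3 (volume.restrict Q₀) →
      Tendsto (fun j => ∫ w' in Q₀,
          ((lam (j + J)) ^ 2 • stPull ((lam (j + J)) ^ 2) (lam (j + J)) (0 : ℝ)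
            (0 : EuclideanSpace ℝ (Fin 3)) π) w'.1 w'.2 * g w')
        atTop (𝓝 (∫ w' in Q₀, ϖ w'.1 w'.2 * g w')) := fun g hg =>
    (hweak g hg).comp (tendsto_add_atTop_nat J)
  -- bounds on the approximants: scale invariance of `𝐈`
  have hbdσ : ∀ j, abScaledSum r z
      ((lam (j + J)) • stPull ((lam (j + J)) ^ 2) (lam (j + J)) (0 : ℝ) (0 : EuclideanSpace ℝ (Fin 3)) v)
      ((lam (j + J)) ^ 2 • stPull ((lam (j + J)) ^ 2) (lam (j + J)) (0 : ℝ) (0 : EuclideanSpace ℝ (Fin 3)) π)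
      ((lam (j + J)) ^ 2 • stPull ((lam (j + J)) ^ 2) (lam (j + J)) (0 : ℝ) (0 : EuclideanSpace ℝ (Fin 3)) G)
        ≤ I := by
    intro j
    refine (abScaledSum_le_typeIBound hr (hzQ.trans (hdom j))).trans ?_
    rw [← stAffine_preimage_parabolicCylinder_zero (hμ j) ρ, typeIBound_nsZoom (hμ j)]
    exact hbd
  -- weak gradients of the approximants
  have hwg : ∀ j, HasWeakSpatialGradientOn
      (parabolicCylinderOpens (ρ / lam (j + J)) (0 : ℝ × EuclideanSpace ℝ (Fin 3)))
      ((lam (j + J)) • stPull ((lam (j + J)) ^ 2) (lam (j + J)) (0 : ℝ) (0 : EuclideanSpace ℝ (Fin 3)) v)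
      ((lam (j + J)) ^ 2 • stPull ((lam (j + J)) ^ 2) (lam (j + J)) (0 : ℝ) (0 : EuclideanSpace ℝ (Fin 3)) G) := by
    intro j
    have h := hGv.stRescale (lam (j + J)) (pow_pos (hμ j) 2) (hμ j) (0 : ℝ)
      (0 : EuclideanSpace ℝ (Fin 3))
    have hpre : stPreimage ((lam (j + J)) ^ 2) (lam (j + J)) (0 : ℝ) (0 : EuclideanSpace ℝ (Fin 3))
        (parabolicCylinderOpens ρ (0 : ℝ × EuclideanSpace ℝ (Fin 3))) =
        parabolicCylinderOpens (ρ / lam (j + J)) (0 : ℝ × EuclideanSpace ℝ (Fin 3)) := by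
      apply Opens.ext
      rw [coe_stPreimage]
      exact stAffine_preimage_parabolicCylinder_zero (hμ j) ρ
    rw [hpre, ← sq] at h
    exact h
  have hvm : ∀ j, AEStronglyMeasurable
      (uncurry ((lam (j + J)) • stPull ((lam (j + J)) ^ 2) (lam (j + J)) (0 : ℝ)
        (0 : EuclideanSpace ℝ (Fin 3)) v)) (volume.restrict Q₀) := fun j =>
    (hwg j).locallyIntegrableOn.aestronglyMeasurable.mono_measure
      (Measure.restrict_mono (hdom j) le_rfl)
  have hum : AEStronglyMeasurable (uncurry w) (volume.restrict Q₀) := hum3.1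
  -- `A`
  have hA : cknAEss r z w ≤ I :=
    cknAEss_le_of_tendsto_eLpNorm hr hzQ hvm hum hconv'
      fun j => cknAEss_le_abScaledSum.trans (hbdσ j)
  -- `C`
  have hC : cknC r z w ≤ I :=
    cknC_le_of_tendsto_eLpNorm hr hzQ hvm hum hconv'
      fun j => cknC_le_abScaledSum.trans (hbdσ j)
  -- `D`
  have hqmem : ∀ j, MemLp
      (uncurry ((lam (j + J)) ^ 2 • stPull ((lam (j + J)) ^ 2) (lam (j + J)) (0 : ℝ)
        (0 : EuclideanSpace ℝ (Fin 3)) π)) (3 / 2) (volume.restrict Q₀) := by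
    intro j
    obtain ⟨-, h32', -⟩ := threeHalves_facts
    have h2 := memLp_comp_zoom (hμ j) (by norm_num) h32' hballv.2.2.2
    have e : uncurry ((lam (j + J)) ^ 2 • stPull ((lam (j + J)) ^ 2) (lam (j + J)) (0 : ℝ)
        (0 : EuclideanSpace ℝ (Fin 3)) π) =
        (lam (j + J)) ^ 2 • (uncurry π ∘ stAffine ((lam (j + J)) ^ 2) (lam (j + J))
          (0 : ℝ) (0 : EuclideanSpace ℝ (Fin 3))) := by
      funext w'
      obtain ⟨s, y⟩ := w'
      simp only [uncurry_apply_pair, Pi.smul_apply, stPull_apply, Function.comp_apply,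
        stAffine_apply]
    rw [e]
    exact (h2.const_smul _).mono_measure (Measure.restrict_mono (hdom j) le_rfl)
  have hD : cknDOsc r z ϖ ≤ I :=
    cknDOsc_le_of_tendsto_weakly hr hzQ hqmem hballu.2.2.2 hweak'
      fun j => cknDOsc_le_abScaledSum.trans (hbdσ j)
  -- `E`
  have hHfin : ∫⁻ w in parabolicCylinder r z, ENNReal.ofReal (frobeniusNormSq (H w.1 w.2)) < ∞ := by
    have e : ∫⁻ w in parabolicCylinder r z, ENNReal.ofReal (frobeniusNormSq (H w.1 w.2)) =
        ∫⁻ w in parabolicCylinder r z, ENNReal.ofReal (frobeniusNormSq (Gn n w.1 w.2)) := by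
      refine setLIntegral_congr_of_ae_imp (isOpen_parabolicCylinder r z).measurableSet hzQ ?_
      filter_upwards [hHae n] with w hw hwS
      have e : H w.1 w.2 = Gn n w.1 w.2 := hw hwS
      rw [e]
    rw [e]
    exact lt_of_le_of_lt (lintegral_mono_set hzQ) (hGn2 n)
  have hE : cknE r z H ≤ I :=
    cknE_le_of_tendsto_eLpNorm hr hzQ
      (fun j => (hwg j).mono (fun w hw => hdom j (hzQ hw))) (hH.mono hleΩ) hHfin hconv'
      fun j => cknE_le_abScaledSum.trans (hbdσ j)
  calc abScaledSum r z w ϖ H = cknAEss r z w + cknC r z w + cknDOsc r z ϖ + cknE r z H := rfl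
    _ ≤ I + I + I + I := add_le_add (add_le_add (add_le_add hA hC) hD) hE
    _ = 4 * I := by ring


end Summit.NavierStokesRegularity.NavierStokesRegularity.Theorems
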